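import Summits.AtomisticToContinuum.HydrodynamicLimit.Theorems.OneFlightGossipEngineClampedTransferDockCubicChannelRateBand
import Summits.AtomisticToContinuum.HydrodynamicLimit.Theorems.OneFlightGossipEngineClampedCurrentsDockHeartPrelims
import Summits.AtomisticToContinuum.HydrodynamicLimit.Theorems.DenseExcursion.Negative.Everywhere
import HarnessLib

/-!
# The rate cubic channel in expectation under the TRUE law (stub `stub_cubicChannelRate`, line `Sketch`,
# crux `ClampedTransferDock`, stmt-AtomisticToContinuum-17615)

Registered stub `stub_cubicChannelRate : CubicChannelRate` of the lead's skeleton `Cruxes/ClampedTransferDock/Lines/Sketch.lean` (v3);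
the def and its two line-internal antecedents `BandCoherenceLDFamily`, `SuperExponentialEnergyTails` are re-declared verbatim (§1),
`CubicChannelPathwise`, `ThirdMomentWindow`, `WindowFlowShift` are the landed ones of the heart
(`Theorems/OneFlightGossipEngineClampedCurrentsDockCubicChannel*.lean`, crux 14680).

The heart pays the suprathermal heat-flux remainder `hi_s = (b_s·w) R_s(x, ‖w‖²)` over one window `[s, s+w]` in expectation
under the true law (`ClampedCurrentsDockCubicChannel.stub_cubicChannel`, the TEMPLATE of this file: pathwise `pathwiseWindowBound`,
in mean `oneWindow`). This line replaces its true-law coherence input S6′: the coherent suprathermal cubic content `1{coh} cubHi` is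
split pointwise into BAND and TOP (companion file `…CubicChannelRateBand`, `coherent_mean_le`);
* the BAND functional `Y = Σ_i 1{coh_i} cubBand_i` is paid by the entropy inequality with respect to the local reference
  `ψ_s = localGibbsLaw σ (ρ_s Rf(σ³ρ_s)) u_s θ_s` at the small tilt `γ = (8 Θ̄ K₁)⁻¹`, `Θ̄ = θM + 1`
  (`band_expectation`), its reference exponential moment being the instance of `BandCoherenceLDFamily` along the explicit
  reference family CLAMPED to `[0, t]` (globally jointly continuous; packing guard from the band guard `ρσ³ < ηQ` and unit
  mass, `guard_of_band_min`), at the radial weight `Rweight = 1{K⋆² < s′} R_s/C_R` of the heart: `E_λ ≤ γ⁻¹ (H_N(s) + e₁(N+1))`;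
* the TOP `cubTop ≤ 8 w⁻¹ ∫ 1{K₁ − U < ‖v‖}‖v‖³` (`K₁ ≥ 2U`) is paid by Tonelli and SEET at rate `2c`, level `K₁ − U`:
  `8 Bb C_R (e^{-2c(K₁−U)} + e₃) ≤ A e^{-cK₁} + ε/8`, `A = 8 Bb C_R`;
* the rest (third moments at accuracy `1`, drift tails at `e₂`, `η`, `δ`, drift `w → 0`) exactly as in the template, the
  cubic tails ECT being a corollary of SEET at rate one.
Constants: `K⋆ = 1`, `C_R = 1 + (5θM + C_G)/K⋆²`, `B = Bb C_R · 8(θM + 1)`, `K₀ = max(K₀ˢ(2c), 2U) + U + 1`.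

prover-line-stmt-AtomisticToContinuum-17615-0 (stub worker `stub_cubicChannelRate`).
-/

noncomputable section

namespace Summit.AtomisticToContinuum.HydrodynamicLimit.Theorems.ClampedTransferDockCubicRate

open scoped BigOperators ENNReal Classical Interval
open MeasureTheory Filter Set Topology InformationTheory
open Literature.MathematicalPhysics.KineticTheory Literature.Analysis.FluidPDE Literature.Analysis.FunctionSpaces
open Summit.AtomisticToContinuum.HydrodynamicLimit.Theses
open Summit.AtomisticToContinuum.HydrodynamicLimit.Theses.OneFlightGossipEngine
open Summit.AtomisticToContinuum.HydrodynamicLimit.Theorems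
open Summit.AtomisticToContinuum.HydrodynamicLimit.Theorems.ClampedCurrentsDockCubicChannelPrelim
open Summit.AtomisticToContinuum.HydrodynamicLimit.Theorems.ClampedCurrentsDockCubicChannel
  (WindowFlowShift ThirdMomentWindow CubicChannelPathwise Rweight Rweight_of_le Rweight_of_mem abs_Rweight_le
    measurable_Rweight oneWindow)
open Summit.AtomisticToContinuum.HydrodynamicLimit.Theorems.ClampedCurrentsDockHeart
  (clampTime clampTime_mem clampTime_of_mem continuous_uncurry_clamp continuousOn_uncurry_of_isSmoothSpaceTimeOn)

/-! ## §1 The statements (verbatim from the line skeleton v3) -/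

/-- registered stub signature `stub_seet` of line Sketch, crux ClampedTransferDock (stmt-AtomisticToContinuum-17615) — route-internal, not a cited fact -/
def SuperExponentialEnergyTails : Prop :=
  ∀ (a₀ θ₀ : T3 → ℝ) (u₀ : T3 → V3), Continuous a₀ → Continuous θ₀ → Continuous u₀ → (∀ x, 0 < a₀ x) →
    (∀ x, 0 < θ₀ x) → ∃ σ₀ : ℝ, 0 < σ₀ ∧ ∀ σ : ℝ, 0 < σ → σ < σ₀ →
    ∀ (T : ℝ) (ρ θ : ℝ → T3 → ℝ) (u : ℝ → T3 → V3), IsHardSphereEulerSolution σ T ρ u θ →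
    ∀ Φ : (N : ℕ) → HardSphereFlow (Torus.geometry (Fin 3)) (hsDiameter σ N) (N + 1),
    TendstoHydroFieldsAt (fun N => localGibbsLaw σ a₀ u₀ θ₀ N (Φ N)) Φ ρ u θ 0 →
    ∀ t ∈ Set.Ico 0 T, ∀ c : ℝ, 0 < c → ∃ K₀ : ℝ, 0 < K₀ ∧ ∀ K : ℝ, K₀ ≤ K → ∀ ε : ℝ, 0 < ε →
    ∃ N₀ : ℕ, ∀ N : ℕ, N₀ ≤ N → ∀ s ∈ Set.Icc 0 t,
      ∫⁻ z, ENNReal.ofReal (((N : ℝ) + 1)⁻¹ * ∑ i : Fin (N + 1),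
          Set.indicator {v : V3 | K < ‖v‖} (fun v => ‖v‖ ^ 3) (((Φ N).flow s z i).2))
        ∂(localGibbsLaw σ a₀ u₀ θ₀ N (Φ N)) ≤ ENNReal.ofReal (Real.exp (-(c * K)) + ε)

/-- registered stub signature `stub_bandCoherenceLD` of line Sketch, crux ClampedTransferDock (stmt-AtomisticToContinuum-17615) — route-internal, not a cited fact -/
def BandCoherenceLDFamily : Prop :=
  ∃ η₀ : ℝ, 0 < η₀ ∧ ∀ (t₁ Θbar : ℝ) (a θ₀ : ℝ → T3 → ℝ) (u₀ : ℝ → T3 → V3),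
    Continuous (Function.uncurry a) → Continuous (Function.uncurry θ₀) → Continuous (Function.uncurry u₀) →
    (∀ s x, 0 < a s x) → (∀ s x, 0 < θ₀ s x) → (∀ s ∈ Set.Icc 0 t₁, ∀ x, θ₀ s x ≤ Θbar) →
    ∀ σ : ℝ, 0 < σ → (∀ s ∈ Set.Icc 0 t₁, σ ^ 3 * (⨆ x, a s x) ≤ η₀ * ∫ x, a s x) →
    ∀ Φ : (N : ℕ) → HardSphereFlow (Torus.geometry (Fin 3)) (hsDiameter σ N) (N + 1),
    ∀ Kstar K₁ : ℝ, 0 < Kstar → Kstar ≤ K₁ →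
    ∀ R : ℝ → T3 → ℝ → ℝ, Measurable (fun p : ℝ × T3 × ℝ => R p.1 p.2.1 p.2.2) →
    (∀ s x s', s' ≤ Kstar ^ 2 → R s x s' = 0) → (∀ s x s', |R s x s'| ≤ |s'|) →
    ∀ η : ℝ, 0 < η → ∀ ε : ℝ, 0 < ε →
    ∃ τ₀ : ℝ, 0 < τ₀ ∧ ∀ τ : ℝ, τ₀ ≤ τ → ∃ N₀ : ℕ, ∀ N : ℕ, N₀ ≤ N → ∀ s ∈ Set.Icc 0 t₁,
      (let w : ℝ := τ * ((N : ℝ) + 1) ^ (-(1 / 3 : ℝ))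
       let P := localGibbsLaw σ (a s) (u₀ s) (θ₀ s) N (Φ N)
       let W := fun (i : Fin (N + 1)) (r : ℝ) (z : Config (N + 1) (Fin 3) T3) =>
         ((Φ N).flow r z i).2 - u₀ s ((Φ N).flow r z i).1
       let cub := fun (i : Fin (N + 1)) (z : Config (N + 1) (Fin 3) T3) =>
         w⁻¹ * ∫ r in (0 : ℝ)..w, ‖W i r z‖ ^ 3
       let cubBand := fun (i : Fin (N + 1)) (z : Config (N + 1) (Fin 3) T3) =>
         w⁻¹ * ∫ r in (0 : ℝ)..w, (if Kstar < ‖W i r z‖ ∧ ‖W i r z‖ ≤ K₁ then ‖W i r z‖ ^ 3 else 0)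
       let qbar := fun (i : Fin (N + 1)) (z : Config (N + 1) (Fin 3) T3) =>
         w⁻¹ • ∫ r in (0 : ℝ)..w, (R s ((Φ N).flow r z i).1 (‖W i r z‖ ^ 2)) • W i r z
       ∫⁻ z, ENNReal.ofReal (Real.exp ((8 * Θbar * K₁)⁻¹ * ∑ i : Fin (N + 1),
              (if η * cub i z < ‖qbar i z‖ then cubBand i z else 0))) ∂P ≤
         ENNReal.ofReal (Real.exp (ε * ((N : ℝ) + 1))))

/-- registered stub signature `stub_cubicChannelRate` of line Sketch, crux ClampedTransferDock (stmt-AtomisticToContinuum-17615) — route-internal, not a cited fact -/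
def CubicChannelRate : Prop :=
  CubicChannelPathwise → ThirdMomentWindow → WindowFlowShift → BandCoherenceLDFamily → SuperExponentialEnergyTails →
  ∀ (r : ℝ) (Rf : ℝ → ℝ), 0 < r → (∀ x ∈ Set.Icc 0 r, 1 ≤ Rf x ∧ Rf x ≤ 2) → ContinuousOn Rf (Set.Icc 0 r) →
  ∃ ηQ : ℝ, 0 < ηQ ∧
  ∀ (a₀ θ₀ : T3 → ℝ) (u₀ : T3 → V3), Continuous a₀ → Continuous θ₀ → Continuous u₀ →
    (∀ x, 0 < a₀ x) → (∀ x, 0 < θ₀ x) →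
    ∃ σ₀ : ℝ, 0 < σ₀ ∧ ∀ σ : ℝ, 0 < σ → σ < σ₀ →
    ∀ (T : ℝ) (ρ θ : ℝ → T3 → ℝ) (u : ℝ → T3 → V3), IsHardSphereEulerSolution σ T ρ u θ →
    (∀ s ∈ Set.Ico 0 T, ∀ x, ρ s x * σ ^ 3 < ηQ) →
    ∀ Φ : (N : ℕ) → HardSphereFlow (Torus.geometry (Fin 3)) (hsDiameter σ N) (N + 1),
    TendstoHydroFieldsAt (fun N => localGibbsLaw σ a₀ u₀ θ₀ N (Φ N)) Φ ρ u θ 0 →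
    ∀ t ∈ Set.Ico 0 T, ∃ Kstar : ℝ, 0 < Kstar ∧
    ∀ (G : ℝ → T3 × ℝ → ℝ) (C_G : ℝ), 0 ≤ C_G → ContinuousOn (Function.uncurry G) (Set.Icc 0 t ×ˢ Set.univ) →
    (∀ s ∈ Set.Icc 0 t, ∀ y : T3 × ℝ, 0 ≤ y.2 → |G s y| ≤ C_G) →
    (∀ s ∈ Set.Icc 0 t, ∀ (x : T3) (s' : ℝ), s' ≤ Kstar ^ 2 → G s (x, s') = s' - 5 * θ s x) →
    ∃ B : ℝ, 0 ≤ B ∧ ∀ c : ℝ, 0 < c → ∃ A : ℝ, 0 ≤ A ∧ ∃ K₀ : ℝ, 0 < K₀ ∧ ∀ K₁ : ℝ, K₀ ≤ K₁ →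
    ∀ ε : ℝ, 0 < ε → ∃ τ₀ : ℝ, 0 < τ₀ ∧ ∀ τ : ℝ, τ₀ ≤ τ → ∃ N₀ : ℕ, ∀ N : ℕ, N₀ ≤ N →
    ∀ s : ℝ, 0 ≤ s → s + τ * ((N : ℝ) + 1) ^ (-(1 / 3 : ℝ)) ≤ t →
      (let w : ℝ := τ * ((N : ℝ) + 1) ^ (-(1 / 3 : ℝ))
       let hi := fun (s : ℝ) (y : T3 × V3) =>
         (∑ k : Fin 3, Torus.partialDeriv k (θ s) y.1 / (2 * (θ s y.1) ^ 2) * (y.2 - u s y.1) k) *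
           (‖y.2 - u s y.1‖ ^ 2 - 5 * θ s y.1 - G s (y.1, ‖y.2 - u s y.1‖ ^ 2))
       ∫⁻ z, ENNReal.ofReal |∫ r in s..(s + w), ∑ i : Fin (N + 1), hi s ((Φ N).flow r z i)|
           ∂(localGibbsLaw σ a₀ u₀ θ₀ N (Φ N)) ≤
         ENNReal.ofReal (w * ((N : ℝ) + 1) * (ε + A * Real.exp (-(c * K₁))) +
           w * (B * K₁) * (klDiv ((Φ N).lawAt (localGibbsLaw σ a₀ u₀ θ₀ N (Φ N)) s)
             (localGibbsLaw σ (fun x => ρ s x * Rf (σ ^ 3 * ρ s x)) (u s) (θ s) N (Φ N))).toReal))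

/-! ## §2 The packing guard of the explicit reference family -/

/-- **The packing guard of the explicit reference family from the band guard** (the instance of the heart's
`HydroLimitInBandHeart.guard_of_band` needed here, stated with the band guard `ρ σ³ < min(η₀/2, r)` of this file): for a continuous
density `ρ > 0` of unit mass and an insertion factor `1 ≤ Rf ≤ 2` on `[0, r]`, the explicit activity `a = ρ Rf(σ³ρ)` satisfies
`σ³ sup a ≤ η₀ ∫ a` (`sup a ≤ 2 · (η₀/2) σ⁻³`, `∫ a ≥ ∫ ρ = 1`). [folklore] -/
theorem guard_of_band_min {r η₀ σ : ℝ} {Rf : ℝ → ℝ} {ρ : T3 → ℝ} (hbd : ∀ x ∈ Icc 0 r, 1 ≤ Rf x ∧ Rf x ≤ 2) (hσ : 0 < σ)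
    (hρ0 : ∀ x, 0 < ρ x) (hρ1 : ∫ x, ρ x = 1) (hpack : ∀ x, ρ x * σ ^ 3 < min (η₀ / 2) r) (hρc : Continuous ρ)
    (hac : Continuous fun x => ρ x * Rf (σ ^ 3 * ρ x)) :
    σ ^ 3 * (⨆ x, ρ x * Rf (σ ^ 3 * ρ x)) ≤ η₀ * ∫ x, ρ x * Rf (σ ^ 3 * ρ x) := by
  -- adapted from `HydroLimitInBandHeart.guard_of_band` (`Theorems/ImplosionDichotomyHydroLimitInBandWindowClause.lean`, 9133-c3)
  have hσ3 : 0 < σ ^ 3 := pow_pos hσ 3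
  have hpr : ∀ x, ρ x * σ ^ 3 < r := fun x => (hpack x).trans_le (min_le_right _ _)
  have hpη : ∀ x, ρ x * σ ^ 3 < η₀ / 2 := fun x => (hpack x).trans_le (min_le_left _ _)
  have hRf : ∀ x, 1 ≤ Rf (σ ^ 3 * ρ x) ∧ Rf (σ ^ 3 * ρ x) ≤ 2 := fun x =>
    hbd _ ⟨mul_nonneg hσ3.le (hρ0 x).le, by nlinarith [hpr x, (hρ0 x).le]⟩
  have hint : 1 ≤ ∫ x, ρ x * Rf (σ ^ 3 * ρ x) := by
    refine hρ1.symm.trans_le (integral_mono (hρc.integrable_of_hasCompactSupport (HasCompactSupport.of_compactSpace _))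
      (hac.integrable_of_hasCompactSupport (HasCompactSupport.of_compactSpace _)) fun x => ?_)
    have h1 := (hRf x).1
    have h0 := (hρ0 x).le
    show ρ x ≤ ρ x * Rf (σ ^ 3 * ρ x)
    nlinarith
  have hsup : (⨆ x, ρ x * Rf (σ ^ 3 * ρ x)) ≤ η₀ / σ ^ 3 := by
    refine ciSup_le fun x => ?_
    rw [le_div_iff₀ hσ3]
    have h1 := (hRf x).2
    have h0 : 0 ≤ ρ x * σ ^ 3 := mul_nonneg (hρ0 x).le hσ3.le
    calc ρ x * Rf (σ ^ 3 * ρ x) * σ ^ 3 = (ρ x * σ ^ 3) * Rf (σ ^ 3 * ρ x) := by ring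
      _ ≤ (ρ x * σ ^ 3) * 2 := mul_le_mul_of_nonneg_left h1 h0
      _ ≤ η₀ := by linarith [hpη x]
  have hη0 : 0 ≤ η₀ := by
    have h0 : 0 ≤ ρ 0 * σ ^ 3 := mul_nonneg (hρ0 0).le hσ3.le
    linarith [hpη 0]
  calc σ ^ 3 * (⨆ x, ρ x * Rf (σ ^ 3 * ρ x)) ≤ σ ^ 3 * (η₀ / σ ^ 3) := by gcongr
    _ = η₀ * 1 := by field_simp
    _ ≤ η₀ * ∫ x, ρ x * Rf (σ ^ 3 * ρ x) := mul_le_mul_of_nonneg_left hint hη0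

/-! ## §3 The stub -/

set_option maxHeartbeats 800000 in -- one declaration: the band LD instance, the entropy step, the coherent split and the
-- heart's one-window bound are all instantiated against the explicit window functionals of the statement
/-- **STUB `stub_cubicChannelRate : CubicChannelRate`** of line `Sketch` (crux `ClampedTransferDock`, stmt-17615): the rate cubic
channel of the heart in expectation under the true law — QC-a pathwise, TM, the band functional by the entropy inequality w.r.t.
`ψ_s` at tilt `(8(θM+1)K₁)⁻¹` fed with the band exponential moment of `BandCoherenceLDFamily` along the clamped explicit reference
family, the top and all cubic tails by SEET; order of choices `K⋆ = 1 → (slab, C_R, B) → c ↦ (A, K₀) → (K₁, ε) ↦ (M, η, e₁, e₂, e₃, δ)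
→ τ₀ → N₀(τ)`. [cite: Yau1991, §2] -/
theorem stub_cubicChannelRate : CubicChannelRate := by
  intro hQC hTM _hFS hBand hSeet r Rf hr hbd hcont
  obtain ⟨η₀B, hη₀B, HB⟩ := hBand
  refine ⟨min (η₀B / 2) r, lt_min (half_pos hη₀B) hr, ?_⟩
  intro a₀ θ₀ u₀ ha hθ hu ha0 hθ0
  obtain ⟨σ₁, hσ₁, hSeetσ⟩ := hSeet a₀ θ₀ u₀ ha hθ hu ha0 hθ0
  refine ⟨min σ₁ (1 / 2), lt_min hσ₁ one_half_pos, ?_⟩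
  intro σ hσ hσ0 T ρ θ u hE hguard Φ hT0 t ht
  have hσ₁' : σ < σ₁ := hσ0.trans_le (min_le_left _ _)
  have hσh : σ < 1 / 2 := hσ0.trans_le (min_le_right _ _)
  have hσ3 : 0 < σ ^ 3 := pow_pos hσ 3
  have hSt := hSeetσ σ hσ hσ₁' T ρ θ u hE Φ hT0 t ht
  refine ⟨1, one_pos, ?_⟩
  intro G C_G hCG hGc hGb hGa
  -- the slab package of the Euler solution on `[0, t]`
  obtain ⟨θM, U, Bb, Lb, hθM, hU, hBb, hLb, hslab⟩ := slab_package hE ht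
  have hθpos' : ∀ s ∈ Icc 0 t, ∀ x, 0 < θ s x := fun s hs => (hslab s hs).2.2.2.1
  have hθle' : ∀ s ∈ Icc 0 t, ∀ x, θ s x ≤ θM := fun s hs => (hslab s hs).2.2.2.2.1
  set CR : ℝ := 1 + (5 * θM + C_G) / (1 : ℝ) ^ 2 with hCRdef
  have hCR : 0 < CR := by positivity
  refine ⟨Bb * CR * (8 * (θM + 1)), by positivity, fun c hc => ?_⟩
  -- SEET at rate `2c`: the band top threshold
  obtain ⟨K₀, hK₀, HSK⟩ := hSt (2 * c) (by positivity)
  refine ⟨8 * Bb * CR, by positivity, max K₀ (2 * U) + U + 1, by positivity, fun K₁ hK₁ ε hε => ?_⟩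
  have hK₁U : K₀ ≤ K₁ - U := by linarith [le_max_left K₀ (2 * U)]
  have h2U : 2 * U ≤ K₁ := by linarith [le_max_right K₀ (2 * U)]
  have hK₁1 : (1 : ℝ) ≤ K₁ := by linarith [le_max_right K₀ (2 * U)]
  have hK₁0 : 0 ≤ K₁ := zero_le_one.trans hK₁1
  -- cubic tails at any accuracy (ECT), a corollary of SEET at rate one
  have hECTt : ∀ e : ℝ, 0 < e → ∃ M : ℝ, ∃ N₀ : ℕ, ∀ N : ℕ, N₀ ≤ N → ∀ s ∈ Icc 0 t,
      ∫⁻ z, ENNReal.ofReal (((N : ℝ) + 1)⁻¹ * ∑ i : Fin (N + 1),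
        Set.indicator {v : V3 | M < ‖v‖} (fun v => ‖v‖ ^ 3) (((Φ N).flow s z i).2)) ∂(localGibbsLaw σ a₀ u₀ θ₀ N (Φ N)) ≤
        ENNReal.ofReal e := by
    -- adapted from `IdeatorOneRound1Rev29.seet_imp_energyCurrentTails` (idea sketch of the line)
    intro e he
    obtain ⟨K₀', -, HK⟩ := hSt 1 one_pos
    obtain ⟨N₀, HN⟩ := HK (max K₀' (-Real.log (e / 2))) (le_max_left _ _) (e / 2) (half_pos he)
    refine ⟨_, N₀, fun N hN s hs => (HN N hN s hs).trans (ENNReal.ofReal_le_ofReal ?_)⟩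
    have h1 : Real.exp (-(1 * max K₀' (-Real.log (e / 2)))) ≤ e / 2 := by
      rw [one_mul]
      calc Real.exp (-max K₀' (-Real.log (e / 2))) ≤ Real.exp (-(-Real.log (e / 2))) :=
            Real.exp_le_exp.2 (neg_le_neg (le_max_right _ _))
        _ = e / 2 := by rw [neg_neg, Real.exp_log (half_pos he)]
    linarith
  -- third moments at accuracy 1 (level `M = max M₁ 0`) and the small parameters
  obtain ⟨M₁, N₁, hN₁⟩ := hECTt 1 one_pos
  have hM : 0 ≤ max M₁ 0 := le_max_right _ _
  set η : ℝ := ε / (8 * (4 * Bb * (max M₁ 0 ^ 3 + 1 + U ^ 3)) + 8) with hηdef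
  have hη : 0 < η := by positivity
  set e₁ : ℝ := ε / (8 * (Bb * CR * (8 * (θM + 1)) * K₁) + 8) with he₁def
  have he₁ : 0 < e₁ := by positivity
  set e₂ : ℝ := ε / (8 * (16 * CR * Bb) + 8) with he₂def
  have he₂ : 0 < e₂ := by positivity
  set e₃ : ℝ := ε / (8 * (8 * Bb * CR) + 8) with he₃def
  have he₃ : 0 < e₃ := by positivity
  set δ : ℝ := ε / (8 * (4 * CR * Lb * (max M₁ 0 ^ 3 + 1 + U ^ 3)) + 8) with hδdef
  have hδ : 0 < δ := by positivity
  -- the explicit reference family along the solution, clamped to `[0, t]`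
  have hIt : Icc 0 t ⊆ Ico 0 T := fun s hs => ⟨hs.1, hs.2.trans_lt ht.2⟩
  have hmass : ∀ s ∈ Ico 0 T, ∫ x, ρ s x = 1 := fun s hs =>
    (DenseExcursionEverywhere.integral_density_eq hE hs).trans
      (DenseExcursionEverywhere.integral_density_zero_eq_one hσh.le ha hθ hu ha0 hθ0 Φ hT0)
  have hρc : ∀ s ∈ Ico 0 T, Continuous (ρ s) := fun s hs => (hE.smooth_density.isSmooth_slice hs).continuous
  have hRfI : ∀ s ∈ Ico 0 T, ∀ x, σ ^ 3 * ρ s x ∈ Icc 0 r := fun s hs x =>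
    ⟨mul_nonneg hσ3.le (hE.density_pos s hs x).le, by
      rw [mul_comm]; exact ((hguard s hs x).trans_le (min_le_right _ _)).le⟩
  have hac : ∀ s ∈ Ico 0 T, Continuous fun x => ρ s x * Rf (σ ^ 3 * ρ s x) := fun s hs =>
    (hρc s hs).mul (hcont.comp_continuous (continuous_const.mul (hρc s hs)) (hRfI s hs))
  have ha0' : ∀ s ∈ Ico 0 T, ∀ x, 0 < ρ s x * Rf (σ ^ 3 * ρ s x) := fun s hs x =>
    mul_pos (hE.density_pos s hs x) (one_pos.trans_le (hbd _ (hRfI s hs x)).1)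
  have hclm : ∀ s, clampTime t s ∈ Icc 0 t := fun s => clampTime_mem ht.1 s
  have hclI : ∀ s, clampTime t s ∈ Ico 0 T := fun s => hIt (hclm s)
  have hρu : Continuous (Function.uncurry fun s x => ρ (clampTime t s) x) :=
    continuous_uncurry_clamp ht.1
      ((continuousOn_uncurry_of_isSmoothSpaceTimeOn hE.smooth_density).mono (prod_mono hIt subset_rfl))
  have hacu : Continuous (Function.uncurry fun s x => ρ (clampTime t s) x * Rf (σ ^ 3 * ρ (clampTime t s) x)) :=
    hρu.mul (hcont.comp_continuous (continuous_const.mul hρu) fun p => hRfI _ (hclI p.1) p.2)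
  have hθcu : Continuous (Function.uncurry fun s => θ (clampTime t s)) :=
    continuous_uncurry_clamp ht.1
      ((continuousOn_uncurry_of_isSmoothSpaceTimeOn hE.smooth_temperature).mono (prod_mono hIt subset_rfl))
  have hucu : Continuous (Function.uncurry fun s => u (clampTime t s)) :=
    continuous_uncurry_clamp ht.1
      ((continuousOn_uncurry_of_isSmoothSpaceTimeOn hE.smooth_velocity).mono (prod_mono hIt subset_rfl))
  have hguardB : ∀ s ∈ Icc 0 t, σ ^ 3 * (⨆ x, ρ (clampTime t s) x * Rf (σ ^ 3 * ρ (clampTime t s) x)) ≤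
      η₀B * ∫ x, ρ (clampTime t s) x * Rf (σ ^ 3 * ρ (clampTime t s) x) := fun s _ =>
    guard_of_band_min hbd hσ (hE.density_pos _ (hclI s)) (hmass _ (hclI s)) (hguard _ (hclI s)) (hρc _ (hclI s))
      (hac _ (hclI s))
  -- the band exponential moment at the reference along the clamped family: tilt `(8(θM+1)K₁)⁻¹`, weight `Rweight`,
  -- level `η / C_R`, accuracy `e₁`
  obtain ⟨τ₀, hτ₀, HBτ⟩ := HB t (θM + 1) (fun s x => ρ (clampTime t s) x * Rf (σ ^ 3 * ρ (clampTime t s) x))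
    (fun s => θ (clampTime t s)) (fun s => u (clampTime t s)) hacu hθcu hucu (fun s x => ha0' _ (hclI s) x)
    (fun s x => hE.temperature_pos _ (hclI s) x)
    (fun s _ x => (hθle' _ (hclm s) x).trans (le_add_of_nonneg_right zero_le_one)) σ hσ hguardB Φ 1 K₁ one_pos hK₁1
    (Rweight θ G t 1 CR) (measurable_Rweight hE.smooth_temperature ht.1 ht.2 hGc) (fun s x _ h => Rweight_of_le s x h)
    (abs_Rweight_le ht.1 one_pos hCG hθpos' hθle' hGb hGa) (η / CR) (by positivity) e₁ he₁
  -- the top: SEET at rate `2c`, level `K₁ − U`, accuracy `e₃`; the drift tails at accuracy `e₂` (level `max M₂ 0 + U`)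
  obtain ⟨N₅, hN₅⟩ := HSK (K₁ - U) hK₁U e₃ he₃
  obtain ⟨M₂, N₂, hN₂⟩ := hECTt e₂ he₂
  have hMv : max M₂ 0 ≤ max M₂ 0 + U := le_add_of_nonneg_right hU
  have hUMv : U ≤ max M₂ 0 + U := le_add_of_nonneg_left (le_max_right _ _)
  refine ⟨τ₀, hτ₀, fun τ hτ => ?_⟩
  have hτ0 : 0 < τ := hτ₀.trans_le hτ
  obtain ⟨N₃, hN₃⟩ := HBτ τ hτ
  -- the window length vanishes: the drift constant `K₄`
  set K₄ : ℝ := 2 * CR * Bb * (max M₂ 0 + U + U) ^ 3 * (max M₁ 0 ^ 3 + 2) / δ with hK₄def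
  have hK₄ : 0 ≤ K₄ := by positivity
  have hc₄ : 0 < ε / (8 * K₄ + 8) := by positivity
  obtain ⟨N₄, hN₄⟩ := eventually_atTop.1 ((tendsto_window_zero τ).eventually (Iio_mem_nhds hc₄))
  refine ⟨max (max N₁ N₂) (max (max N₃ N₄) N₅), fun N hN s hs0 hsw => ?_⟩
  simp only [max_le_iff] at hN
  obtain ⟨⟨hN₁N, hN₂N⟩, ⟨hN₃N, hN₄N⟩, hN₅N⟩ := hN
  intro w hi
  have hw : 0 < w := mul_pos hτ0 (Real.rpow_pos_of_pos (by positivity) _)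
  have hsw' : s + w ≤ t := hsw
  have hwlt : w < ε / (8 * K₄ + 8) := hN₄ N hN₄N
  have hst : s ≤ t := by linarith
  have hsI : s ∈ Icc 0 t := ⟨hs0, hst⟩
  have hsT : s ∈ Ico 0 T := hIt hsI
  have hN1 : (0 : ℝ) < (N : ℝ) + 1 := by positivity
  obtain ⟨hθc, huc, hbc, hθpos, hθle, hule, hble, hblip⟩ := hslab s hsI
  have hGsc : Continuous (G s) :=
    hGc.comp_continuous (continuous_const.prodMk continuous_id) fun y => mk_mem_prod hsI (mem_univ _)
  -- the per-time cubic tails on the window: third moments, drift tails, top tails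
  have hECT1 : ∀ r ∈ Icc s (s + w), ∫⁻ z, ENNReal.ofReal (((N : ℝ) + 1)⁻¹ * ∑ i : Fin (N + 1),
      Set.indicator {v : V3 | max M₁ 0 < ‖v‖} (fun v => ‖v‖ ^ 3) (((Φ N).flow r z i).2))
        ∂(localGibbsLaw σ a₀ u₀ θ₀ N (Φ N)) ≤ ENNReal.ofReal 1 := fun r hr =>
    (lintegral_tail_mono (Φ N) _ (le_max_left M₁ 0) r).trans (hN₁ N hN₁N r ⟨hs0.trans hr.1, hr.2.trans hsw'⟩)
  have hECT2 : ∀ r ∈ Icc s (s + w), ∫⁻ z, ENNReal.ofReal (((N : ℝ) + 1)⁻¹ * ∑ i : Fin (N + 1),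
      Set.indicator {v : V3 | max M₂ 0 + U < ‖v‖} (fun v => ‖v‖ ^ 3) (((Φ N).flow r z i).2))
        ∂(localGibbsLaw σ a₀ u₀ θ₀ N (Φ N)) ≤ ENNReal.ofReal e₂ := fun r hr =>
    (lintegral_tail_mono (Φ N) _ ((le_max_left M₂ 0).trans hMv) r).trans
      (hN₂ N hN₂N r ⟨hs0.trans hr.1, hr.2.trans hsw'⟩)
  have hTop : ∀ r ∈ Icc s (s + w), ∫⁻ z, ENNReal.ofReal (((N : ℝ) + 1)⁻¹ * ∑ i : Fin (N + 1),
      Set.indicator {v : V3 | K₁ - U < ‖v‖} (fun v => ‖v‖ ^ 3) (((Φ N).flow r z i).2))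
        ∂(localGibbsLaw σ a₀ u₀ θ₀ N (Φ N)) ≤ ENNReal.ofReal (Real.exp (-(2 * c * (K₁ - U))) + e₃) := fun r hr =>
    hN₅ N hN₅N r ⟨hs0.trans hr.1, hr.2.trans hsw'⟩
  -- the band exponential moment at `(N, s)`: the clamp is the identity at `s`, the weight is `R_s / C_R` there
  have hBN := hN₃ N hN₃N s hsI
  simp only [clampTime_of_mem hsI, Rweight_of_mem hsI (hGa s hsI)] at hBN
  -- the band functional in expectation under the true law (entropy inequality w.r.t. `ψ_s`)
  have hRw : Measurable fun p : T3 × ℝ => (p.2 - 5 * θ s p.1 - G s (p.1, p.2)) / CR :=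
    ((measurable_snd.sub ((hθc.measurable.comp measurable_fst).const_mul 5)).sub
      (hGsc.measurable.comp (measurable_fst.prodMk measurable_snd))).div_const _
  have hBE := band_expectation (Φ N) (Rw := fun x s' => (s' - 5 * θ s x - G s (x, s')) / CR) hσ hσh ha hθ hu ha0 hθ0
    (hac s hsT) hθc huc (ha0' s hsT) hθpos hRw hK₁0 hs0 hw (by positivity) hBN
  -- the coherent term in mean (band + top), then one window in mean as in the heart
  have hcoh := coherent_mean_le (Φ N) (us := u s) (Rw := fun x s' => (s' - 5 * θ s x - G s (x, s')) / CR)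
    (Kstar := (1 : ℝ)) (K₁ := K₁) (U := U) (η := η / CR) (s := s) (w := w) hσ hσh ha hθ hu ha0 hθ0 h2U hw (by positivity)
    (by positivity) huc hule hTop hBE
  have hOW := oneWindow hQC hTM (Φ N) (bs := bfield θ s) hσ hσh ha hθ hu ha0 hθ0 one_pos hCG hBb hLb hU hθM hη hs0 hw hM
    hUMv hδ (by positivity) he₂.le hθc huc hbc hGsc hθpos hθle hule hble hblip (hGb s hsI) (hGa s hsI) hCRdef hECT1 hECT2 hcoh
  refine hOW.trans (ENNReal.ofReal_le_ofReal ?_)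
  -- bookkeeping: six small terms `≤ ε/8`, the top rate `e^{-2c(K₁-U)} ≤ e^{-cK₁}`, the entropy term verbatim
  have hwN : 0 ≤ w * ((N : ℝ) + 1) := by positivity
  have h1 : 4 * Bb * (max M₁ 0 ^ 3 + 1 + U ^ 3) * η ≤ ε / 8 := by
    rw [hηdef]; exact mul_frac_le (by positivity) hε.le
  have h2 : Bb * CR * (8 * (θM + 1)) * K₁ * e₁ ≤ ε / 8 := by rw [he₁def]; exact mul_frac_le (by positivity) hε.le
  have h3 : 16 * CR * Bb * e₂ ≤ ε / 8 := by rw [he₂def]; exact mul_frac_le (by positivity) hε.le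
  have h4 : 8 * Bb * CR * e₃ ≤ ε / 8 := by rw [he₃def]; exact mul_frac_le (by positivity) hε.le
  have h5 : 4 * CR * Lb * (max M₁ 0 ^ 3 + 1 + U ^ 3) * δ ≤ ε / 8 := by
    rw [hδdef]; exact mul_frac_le (by positivity) hε.le
  have h6 : 2 * CR * Bb * (w * (max M₂ 0 + U + U) ^ 3 / δ) * (max M₁ 0 ^ 3 + 2) ≤ ε / 8 := by
    have e : 2 * CR * Bb * (w * (max M₂ 0 + U + U) ^ 3 / δ) * (max M₁ 0 ^ 3 + 2) = K₄ * w := by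
      rw [hK₄def]; ring
    rw [e]
    calc K₄ * w ≤ K₄ * (ε / (8 * K₄ + 8)) := mul_le_mul_of_nonneg_left hwlt.le hK₄
      _ ≤ ε / 8 := mul_frac_le hK₄ hε.le
  have hX : Real.exp (-(2 * c * (K₁ - U))) ≤ Real.exp (-(c * K₁)) := Real.exp_le_exp.2 (by nlinarith)
  have p1 := mul_le_mul_of_nonneg_left h1 hwN
  have p2 := mul_le_mul_of_nonneg_left h2 hwN
  have p3 := mul_le_mul_of_nonneg_left h3 hwN
  have p4 := mul_le_mul_of_nonneg_left h4 hwN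
  have p5 := mul_le_mul_of_nonneg_left h5 hwN
  have p6 := mul_le_mul_of_nonneg_left h6 hwN
  have pX := mul_le_mul_of_nonneg_left (mul_le_mul_of_nonneg_left hX (by positivity : (0 : ℝ) ≤ 8 * Bb * CR)) hwN
  have hwNε : 0 ≤ w * ((N : ℝ) + 1) * ε := by positivity
  have hsimp : ∀ Z₁ Z₂ : ℝ, Bb * CR * (w * ((N : ℝ) + 1)) * (((N : ℝ) + 1)⁻¹ * Z₁ + 8 * Z₂) =
      Bb * CR * w * Z₁ + Bb * CR * (w * ((N : ℝ) + 1)) * (8 * Z₂) := fun Z₁ Z₂ => by field_simp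
  rw [hsimp, inv_inv]
  linarith [p1, p2, p3, p4, p5, p6, pX, hwNε]

end Summit.AtomisticToContinuum.HydrodynamicLimit.Theorems.ClampedTransferDockCubicRate

end
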